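import Mathlib
import Summits.NavierStokesRegularity.NavierStokesRegularity.Theorems.WakeRatchetTailRatchetDyadicTypeI
import HarnessLib

/-!
# `WakeRatchet.TailRatchet` (stmt-NavierStokesRegularity-21808), door D4′ — the TYPE-I BLOW-UP RATE of
# the non-negative dyadic chain, part 2: `(T − t)·Λᴺ X_N(t) ≤ 2Λ²/(Λ−1)²` on every interval of regularity

Companion of `WakeRatchetTailRatchetDyadicTypeI` (the Riccati functional).  MODEL lattice ODEs only
(the scalar dyadic chain `Ẋₙ = Λⁿ⁻¹ Xₙ₋₁² − Λⁿ Xₙ Xₙ₊₁` of Tao 2016 §1.2 / §4 with `m = 1`, any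
`Λ > 1`); nothing here is a statement about the Navier–Stokes equations; stmt-21808 is neither proved
nor refuted here; no stub of skeleton d00b85951d7c is closed.

* `blowup_time_le` — ℕ-indexed statement: shells `Zⱼ`, `j ≥ 0`, above an anchor, obeying the
  dyadic law `dZⱼ₊₁ ≥ Λʲ Zⱼ² − Λʲ⁺¹ Zⱼ₊₁ Zⱼ₊₂` and `dZ₀ ≥ −Z₀Z₁` (ANY non-negative feed into the
  anchor) on `(a, T)`, regular on every `(a, T′)`, `T′ < T` (geometric envelopes
  `|Zⱼ|, |dZⱼ| ≤ BΛ⁻ʲ`): for every `t₀ ∈ (a, T)` with `Zⱼ(t₀) ≥ 0` (`j ≥ 1`),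
  `(T − t₀)·Z₀(t₀) ≤ 2Λ²/(Λ−1)²`.  Proof: the series `P = Σ Zⱼ` is differentiable on `(a, T′)`
  (`hasDerivAt_tsum_of_isPreconnected`) with `P' ≥ (Λ−1)²/(2Λ²)·P²` (`sq_growth_at_instant`), and
  `P(t₀) ≥ Z₀(t₀)`; apply `time_le_of_sq_growth` on `[t₀, T′)` and let `T′ ↑ T`.
* `typeI_dyadic` — the ℤ-indexed dyadic chain: if `X` solves the law at every shell `n ≥ N` on
  `(a, T)` and `Λⁿ|Xₙ|` is bounded on `(a, T′)` for every `T′ < T` (shells `n ≥ N − 1`), then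
  `(T − t₀)·Λᴺ X_N(t₀) ≤ 2Λ²/(Λ−1)²` at every `t₀ ∈ (a, T)` at which the shells above `N` are
  non-negative.  READ AT THE MAXIMAL TIME OF REGULARITY `T = T*`:
  `sup_n Λⁿ Xₙ(t) ≤ 2Λ²/((Λ−1)²(T* − t))` — the scale-critical (type-I) rate of the non-negative
  dyadic blow-up with a constant depending on `Λ` only, i.e. `UniformBound` (with that constant) of
  every renormalised frame `W_n(σ) = Λⁿ(T* − t)Xₙ(t)`; this is the «uniform bound» input of the
  Cauchy side of door D4′ (`WakeRatchetStall.tailRatchet_false_of_persistentFiring`,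
  `WakeRatchetStallLimit.tailRatchet_false_of_firingFrames`).  In particular every non-negative
  regular solution with some `X_N(t₀) > 0` loses regularity by `t₀ + 2Λ²/((Λ−1)² Λᴺ X_N(t₀))`.

HONEST FRAMING: elementary real analysis on the lemma layer; the remaining Cauchy-side inputs of door
D4′ (per-shell action bound, post-firing decay / firing gaps, the extraction, and the Cauchy theory
producing regular non-negative solutions up to `T*`) are NOT addressed; rung 0.
-/

noncomputable section

set_option linter.dupNamespace false

namespace Summit.NavierStokesRegularity.NavierStokesRegularity.Theorems

namespace WakeRatchetDyadicTypeI

open Set Filter Topology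

/-! ## Blow-up time bound, ℕ-indexed (shells above the anchor) -/

/-- **Blow-up within `2Λ²/((Λ−1)² Z₀(t₀))`.**  Let `Λ > 1` and let `Zⱼ` (`j ≥ 0`) be differentiable on
`(a, T)` with derivatives `dZⱼ` obeying the dyadic law above the anchor shell,
`dZⱼ₊₁ = … ≥ Λʲ Zⱼ² − Λʲ⁺¹ Zⱼ₊₁ Zⱼ₊₂`, and `dZ₀ ≥ −Z₀Z₁` (any non-negative feed into shell `0`).
Suppose the family is REGULAR on every `(a, T′)`, `T′ < T` (geometric envelopes
`|Zⱼ|, |dZⱼ| ≤ B Λ⁻ʲ`).  Then for every `t₀ ∈ (a, T)` at which `Zⱼ(t₀) ≥ 0` for `j ≥ 1`: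
`(T − t₀)·Z₀(t₀) ≤ 2Λ²/(Λ−1)²`.
[cite: Tao2016AveragedNS, §1.2 (dyadic model), §4 Lemma 4.1 (4.8); elementary] -/
theorem blowup_time_le {Λ a T : ℝ} (hΛ : 1 < Λ) {Z dZ : ℕ → ℝ → ℝ}
    (hder : ∀ j, ∀ t ∈ Ioo a T, HasDerivAt (Z j) (dZ j t) t)
    (h0 : ∀ t ∈ Ioo a T, -(Z 0 t * Z 1 t) ≤ dZ 0 t)
    (hS : ∀ j, ∀ t ∈ Ioo a T,
      Λ ^ j * Z j t ^ 2 - Λ ^ (j + 1) * Z (j + 1) t * Z (j + 2) t ≤ dZ (j + 1) t)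
    (hreg : ∀ T', T' < T → ∃ B : ℝ, ∀ j, ∀ t ∈ Ioo a T', |Z j t| ≤ B * Λ⁻¹ ^ j ∧ |dZ j t| ≤ B * Λ⁻¹ ^ j)
    {t₀ : ℝ} (ht₀ : t₀ ∈ Ioo a T) (hpos : ∀ j, 0 ≤ Z (j + 1) t₀) :
    (T - t₀) * Z 0 t₀ ≤ 2 * Λ ^ 2 / (Λ - 1) ^ 2 := by
  have hΛ0 : 0 < Λ := by linarith
  have hΛ1 : 0 < Λ - 1 := by linarith
  have hC : 0 < 2 * Λ ^ 2 / (Λ - 1) ^ 2 := by positivity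
  -- trivial when `Z₀(t₀) ≤ 0`
  rcases le_or_gt (Z 0 t₀) 0 with hz0 | hz0
  · have : (T - t₀) * Z 0 t₀ ≤ 0 :=
      mul_nonpos_iff.2 (Or.inl ⟨by linarith [ht₀.2], hz0⟩)
    linarith
  -- the bound on every `[t₀, T')`, `T' < T`
  have key : ∀ T', t₀ < T' → T' < T → (T' - t₀) * Z 0 t₀ ≤ 2 * Λ ^ 2 / (Λ - 1) ^ 2 := by
    intro T' hT'0 hT'T
    obtain ⟨B, hB⟩ := hreg T' hT'T
    have hU : IsOpen (Ioo a T') := isOpen_Ioo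
    have hU' : IsPreconnected (Ioo a T') := isPreconnected_Ioo
    have ht₀U : t₀ ∈ Ioo a T' := ⟨ht₀.1, hT'0⟩
    have hsub : Ioo a T' ⊆ Ioo a T := Ioo_subset_Ioo_right hT'T.le
    -- `P = Σ Zⱼ` is differentiable on `(a, T')` with derivative `Σ dZⱼ`
    set P : ℝ → ℝ := fun t => ∑' j, Z j t with hPdef
    have hPder : ∀ t ∈ Ioo a T', HasDerivAt P (∑' j, dZ j t) t := by
      intro t ht
      exact hasDerivAt_tsum_of_isPreconnected ((summable_inv_pow hΛ).mul_left B) hU hU'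
        (fun j y hy => hder j y (hsub hy)) (fun j y hy => by
          rw [Real.norm_eq_abs]; exact (hB j y hy).2) ht₀U
        (summable_of_envelope hΛ fun j => (hB j t₀ ht₀U).1) ht
    -- the Riccati inequality on `[t₀, T')`
    have hgrow : ∀ t ∈ Ico t₀ T', (Λ - 1) ^ 2 / (2 * Λ ^ 2) * P t ^ 2 ≤ ∑' j, dZ j t := by
      intro t ht
      have htU : t ∈ Ioo a T' := ⟨ht₀.1.trans_le ht.1, ht.2⟩
      have htT : t ∈ Ioo a T := hsub htU
      exact sq_growth_at_instant hΛ (fun j => (hB j t htU).1)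
        (summable_of_envelope hΛ fun j => (hB j t htU).2) (h0 t htT) (fun j => hS j t htT)
    -- `P(t₀) ≥ Z₀(t₀) > 0`
    have hsum0 : Summable fun j => Z j t₀ := summable_of_envelope hΛ fun j => (hB j t₀ ht₀U).1
    have hP0 : Z 0 t₀ ≤ P t₀ := by
      simp only [hPdef]
      rw [hsum0.tsum_eq_zero_add]
      have : 0 ≤ ∑' j, Z (j + 1) t₀ := tsum_nonneg hpos
      linarith
    have hP0pos : 0 < P t₀ := hz0.trans_le hP0
    have hk : 0 < (Λ - 1) ^ 2 / (2 * Λ ^ 2) := by positivity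
    have hcomp := time_le_of_sq_growth hk hT'0
      (fun t ht => hPder t ⟨ht₀.1.trans_le ht.1, ht.2⟩) hgrow hP0pos
    have hTt : 0 ≤ T' - t₀ := by linarith
    calc (T' - t₀) * Z 0 t₀ ≤ (T' - t₀) * P t₀ := mul_le_mul_of_nonneg_left hP0 hTt
      _ ≤ ((Λ - 1) ^ 2 / (2 * Λ ^ 2))⁻¹ := hcomp
      _ = 2 * Λ ^ 2 / (Λ - 1) ^ 2 := by rw [inv_div]
  -- pass to `T`
  by_contra hcon
  push Not at hcon
  set C : ℝ := 2 * Λ ^ 2 / (Λ - 1) ^ 2 with hCdef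
  -- the instant `s = t₀ + (C/Z₀(t₀) + (T − t₀))/2` contradicts `key`
  have hCZ : C / Z 0 t₀ < T - t₀ := by
    rw [div_lt_iff₀ hz0]; linarith
  set s : ℝ := t₀ + (C / Z 0 t₀ + (T - t₀)) / 2 with hsdef
  have hs0 : t₀ < s := by
    have : 0 < C / Z 0 t₀ := div_pos hC hz0
    rw [hsdef]; linarith
  have hsT : s < T := by rw [hsdef]; linarith
  have h := key s hs0 hsT
  have : (s - t₀) * Z 0 t₀ = (C + (T - t₀) * Z 0 t₀) / 2 := by
    rw [hsdef]; field_simp; ring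
  rw [this] at h
  linarith

/-! ## The ℤ-indexed dyadic chain: the type-I rate -/

section Corollary

variable {Λ : ℝ}

/-- Envelope of the law above the anchor: `|Λʲx² − Λʲ⁺¹yw| ≤ 2ΛB²·Λ⁻¹⁽ʲ⁺¹⁾` under the geometric
envelopes of `x, y, w`. [folklore] -/
theorem envelope_succ (hΛ : 1 < Λ) {B x y w : ℝ} {j : ℕ} (hx : |x| ≤ |B| * Λ⁻¹ ^ j)
    (hy : |y| ≤ |B| * Λ⁻¹ ^ (j + 1)) (hw : |w| ≤ |B| * Λ⁻¹ ^ (j + 2)) :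
    |Λ ^ j * x ^ 2 - Λ ^ (j + 1) * y * w| ≤ 2 * Λ * B ^ 2 * Λ⁻¹ ^ (j + 1) := by
  have hΛ0 : 0 < Λ := by linarith
  have hq0 : 0 ≤ Λ⁻¹ := by positivity
  have hq1 : Λ⁻¹ ≤ 1 := inv_le_one_of_one_le₀ hΛ.le
  have h1 : |Λ ^ j * x ^ 2 - Λ ^ (j + 1) * y * w| ≤ Λ ^ j * x ^ 2 + Λ ^ (j + 1) * (|y| * |w|) := by
    have := abs_sub (Λ ^ j * x ^ 2) (Λ ^ (j + 1) * y * w)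
    have ha : |Λ ^ j * x ^ 2| = Λ ^ j * x ^ 2 := abs_of_nonneg (by positivity)
    have hb : |Λ ^ (j + 1) * y * w| = Λ ^ (j + 1) * (|y| * |w|) := by
      rw [abs_mul, abs_mul, abs_of_nonneg (by positivity : (0:ℝ) ≤ Λ ^ (j + 1))]; ring
    linarith [ha, hb]
  have h2 : Λ ^ j * x ^ 2 ≤ B ^ 2 * Λ⁻¹ ^ j := by
    have hx2 : x ^ 2 ≤ (|B| * Λ⁻¹ ^ j) ^ 2 := by
      rw [← sq_abs x]; exact pow_le_pow_left₀ (abs_nonneg _) hx 2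
    calc Λ ^ j * x ^ 2 ≤ Λ ^ j * (|B| * Λ⁻¹ ^ j) ^ 2 := mul_le_mul_of_nonneg_left hx2 (by positivity)
      _ = |B| ^ 2 * Λ⁻¹ ^ j * (Λ ^ j * Λ⁻¹ ^ j) := by ring
      _ = B ^ 2 * Λ⁻¹ ^ j := by rw [pow_mul_inv_pow hΛ, mul_one, sq_abs]
  have h3 : Λ ^ (j + 1) * (|y| * |w|) ≤ B ^ 2 * Λ⁻¹ ^ j := by
    have hyw : |y| * |w| ≤ (|B| * Λ⁻¹ ^ (j + 1)) * (|B| * Λ⁻¹ ^ (j + 2)) :=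
      mul_le_mul hy hw (abs_nonneg _) (by positivity)
    have hq2 : Λ⁻¹ ^ (j + 2) ≤ Λ⁻¹ ^ j := pow_le_pow_of_le_one hq0 hq1 (by omega)
    calc Λ ^ (j + 1) * (|y| * |w|) ≤ Λ ^ (j + 1) * ((|B| * Λ⁻¹ ^ (j + 1)) * (|B| * Λ⁻¹ ^ (j + 2))) :=
          mul_le_mul_of_nonneg_left hyw (by positivity)
      _ = |B| ^ 2 * Λ⁻¹ ^ (j + 2) * (Λ ^ (j + 1) * Λ⁻¹ ^ (j + 1)) := by ring
      _ = B ^ 2 * Λ⁻¹ ^ (j + 2) := by rw [pow_mul_inv_pow hΛ, mul_one, sq_abs]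
      _ ≤ B ^ 2 * Λ⁻¹ ^ j := mul_le_mul_of_nonneg_left hq2 (sq_nonneg _)
  have h4 : 2 * Λ * B ^ 2 * Λ⁻¹ ^ (j + 1) = 2 * (B ^ 2 * Λ⁻¹ ^ j) := by
    have hΛinv : Λ * Λ⁻¹ = 1 := mul_inv_cancel₀ hΛ0.ne'
    calc 2 * Λ * B ^ 2 * Λ⁻¹ ^ (j + 1) = 2 * (B ^ 2 * Λ⁻¹ ^ j) * (Λ * Λ⁻¹) := by
          rw [pow_succ]; ring
      _ = 2 * (B ^ 2 * Λ⁻¹ ^ j) := by rw [hΛinv, mul_one]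
  rw [h4]
  linarith

/-- Envelope of the anchor shell's law: `|Λ⁻¹v² − xy| ≤ 2ΛB²`. [folklore] -/
theorem envelope_zero (hΛ : 1 < Λ) {B v x y : ℝ} (hv : |v| ≤ Λ * |B|) (hx : |x| ≤ |B|)
    (hy : |y| ≤ |B| * Λ⁻¹) : |Λ⁻¹ * v ^ 2 - x * y| ≤ 2 * Λ * B ^ 2 := by
  have hΛ0 : 0 < Λ := by linarith
  have hq0 : 0 ≤ Λ⁻¹ := by positivity
  have hq1 : Λ⁻¹ ≤ 1 := inv_le_one_of_one_le₀ hΛ.le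
  have h1 : |Λ⁻¹ * v ^ 2 - x * y| ≤ Λ⁻¹ * v ^ 2 + |x| * |y| := by
    have := abs_sub (Λ⁻¹ * v ^ 2) (x * y)
    have ha : |Λ⁻¹ * v ^ 2| = Λ⁻¹ * v ^ 2 := abs_of_nonneg (by positivity)
    have hb : |x * y| = |x| * |y| := abs_mul x y
    linarith [ha, hb]
  have h2 : Λ⁻¹ * v ^ 2 ≤ Λ * B ^ 2 := by
    have hv2 : v ^ 2 ≤ (Λ * |B|) ^ 2 := by
      rw [← sq_abs v]; exact pow_le_pow_left₀ (abs_nonneg _) hv 2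
    calc Λ⁻¹ * v ^ 2 ≤ Λ⁻¹ * (Λ * |B|) ^ 2 := mul_le_mul_of_nonneg_left hv2 hq0
      _ = Λ * B ^ 2 * (Λ * Λ⁻¹) := by rw [mul_pow, sq_abs]; ring
      _ = Λ * B ^ 2 := by rw [mul_inv_cancel₀ hΛ0.ne', mul_one]
  have h3 : |x| * |y| ≤ Λ * B ^ 2 := by
    have hxy : |x| * |y| ≤ |B| * (|B| * Λ⁻¹) := mul_le_mul hx hy (abs_nonneg _) (abs_nonneg _)
    have : |B| * (|B| * Λ⁻¹) = B ^ 2 * Λ⁻¹ := by rw [← sq_abs B]; ring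
    rw [this] at hxy
    have hB2 : 0 ≤ B ^ 2 := sq_nonneg _
    nlinarith [mul_le_mul_of_nonneg_left hq1 hB2, mul_le_mul_of_nonneg_left hΛ.le hB2]
  linarith

/-- **TYPE-I RATE FOR THE NON-NEGATIVE DYADIC CHAIN.**  Let `Λ > 1` and let `X : ℤ → ℝ → ℝ` solve
`Ẋₙ = Λⁿ⁻¹ Xₙ₋₁² − Λⁿ Xₙ Xₙ₊₁` on `(a, T)` for every shell `n ≥ N`, with the family regular on every
`(a, T′)`, `T′ < T`, above shell `N − 1` (`Λⁿ|Xₙ| ≤ B` there).  Then for every `t₀ ∈ (a, T)` at which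
`Xₙ(t₀) ≥ 0` for `n > N`:  `(T − t₀)·Λᴺ X_N(t₀) ≤ 2Λ²/(Λ−1)²`.  With `T = T*` the maximal time of
regularity this is the scale-critical (type-I) blow-up rate `Λⁿ Xₙ(t) ≤ 2Λ²/((Λ−1)²(T* − t))` at
every shell, constant depending on `Λ` only — the «uniform bound» input of door D4′ of the census of
stmt-21808 (`WakeRatchetStall.tailRatchet_false_of_persistentFiring` and companions).
[cite: Tao2016AveragedNS, §1.2 (the dyadic Katz–Pavlović model) and §4 Lemma 4.1 (4.8) with `m = 1`; elementary] -/
theorem typeI_dyadic {a T : ℝ} (hΛ : 1 < Λ) {X : ℤ → ℝ → ℝ} {N : ℤ}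
    (hlaw : ∀ n : ℤ, N ≤ n → ∀ t ∈ Ioo a T,
      HasDerivAt (X n) (Λ ^ (n - 1) * X (n - 1) t ^ 2 - Λ ^ n * X n t * X (n + 1) t) t)
    (hreg : ∀ T', T' < T → ∃ B : ℝ, ∀ n : ℤ, N - 1 ≤ n → ∀ t ∈ Ioo a T', |Λ ^ n * X n t| ≤ B)
    {t₀ : ℝ} (ht₀ : t₀ ∈ Ioo a T) (hpos : ∀ n : ℤ, N < n → 0 ≤ X n t₀) :
    (T - t₀) * (Λ ^ N * X N t₀) ≤ 2 * Λ ^ 2 / (Λ - 1) ^ 2 := by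
  have hΛ0 : 0 < Λ := by linarith
  have hΛne : Λ ≠ 0 := hΛ0.ne'
  -- the rescaled shells above the anchor, their derivatives, and the shell below the anchor
  set Z : ℕ → ℝ → ℝ := fun j t => Λ ^ N * X (N + j) t with hZdef
  set dZ : ℕ → ℝ → ℝ := fun j t =>
    Λ ^ N * (Λ ^ (N + j - 1) * X (N + j - 1) t ^ 2 - Λ ^ (N + j) * X (N + j) t * X (N + j + 1) t)
    with hdZdef
  set V : ℝ → ℝ := fun t => Λ ^ N * X (N - 1) t with hVdef
  -- zpow bookkeeping: `Λᴺ Λ^{N+j} = Λʲ (Λᴺ)²`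
  have hzz : ∀ j : ℕ, Λ ^ N * Λ ^ (N + (j : ℤ)) = Λ ^ j * (Λ ^ N * Λ ^ N) := by
    intro j
    rw [zpow_add₀ hΛne, zpow_natCast]; ring
  have hder : ∀ j, ∀ t ∈ Ioo a T, HasDerivAt (Z j) (dZ j t) t := by
    intro j t ht
    have h := (hlaw (N + j) (by omega) t ht).const_mul (Λ ^ N)
    simpa only [hZdef, hdZdef] using h
  -- the anchor shell: `dZ₀ = Λ⁻¹ V² − Z₀ Z₁`
  have hdZ0 : ∀ t, dZ 0 t = Λ⁻¹ * V t ^ 2 - Z 0 t * Z 1 t := by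
    intro t
    simp only [hZdef, hdZdef, hVdef, Nat.cast_zero, add_zero, Nat.cast_one]
    rw [zpow_sub_one₀ hΛne]
    field_simp
  -- the shells above: `dZⱼ₊₁ = Λʲ Zⱼ² − Λʲ⁺¹ Zⱼ₊₁ Zⱼ₊₂`
  have hdZsucc : ∀ j t, dZ (j + 1) t = Λ ^ j * Z j t ^ 2 - Λ ^ (j + 1) * Z (j + 1) t * Z (j + 2) t := by
    intro j t
    have e1 : N + ((j + 1 : ℕ) : ℤ) - 1 = N + (j : ℤ) := by push_cast; ring
    have e2 : N + ((j + 1 : ℕ) : ℤ) + 1 = N + ((j + 2 : ℕ) : ℤ) := by push_cast; ring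
    simp only [hZdef, hdZdef]
    rw [e1, e2, mul_sub]
    congr 1
    · calc Λ ^ N * (Λ ^ (N + (j : ℤ)) * X (N + (j : ℤ)) t ^ 2)
          = (Λ ^ N * Λ ^ (N + (j : ℤ))) * X (N + (j : ℤ)) t ^ 2 := by ring
        _ = Λ ^ j * (Λ ^ N * Λ ^ N) * X (N + (j : ℤ)) t ^ 2 := by rw [hzz j]
        _ = Λ ^ j * (Λ ^ N * X (N + (j : ℤ)) t) ^ 2 := by ring
    · calc Λ ^ N * (Λ ^ (N + ((j + 1 : ℕ) : ℤ)) * X (N + ((j + 1 : ℕ) : ℤ)) t * X (N + ((j + 2 : ℕ) : ℤ)) t)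
          = (Λ ^ N * Λ ^ (N + ((j + 1 : ℕ) : ℤ))) * X (N + ((j + 1 : ℕ) : ℤ)) t
              * X (N + ((j + 2 : ℕ) : ℤ)) t := by ring
        _ = Λ ^ (j + 1) * (Λ ^ N * Λ ^ N) * X (N + ((j + 1 : ℕ) : ℤ)) t
              * X (N + ((j + 2 : ℕ) : ℤ)) t := by rw [hzz (j + 1)]
        _ = Λ ^ (j + 1) * (Λ ^ N * X (N + ((j + 1 : ℕ) : ℤ)) t)
              * (Λ ^ N * X (N + ((j + 2 : ℕ) : ℤ)) t) := by ring
  have h0 : ∀ t ∈ Ioo a T, -(Z 0 t * Z 1 t) ≤ dZ 0 t := by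
    intro t _
    rw [hdZ0 t]
    have : 0 ≤ Λ⁻¹ * V t ^ 2 := by positivity
    linarith
  have hS : ∀ j, ∀ t ∈ Ioo a T,
      Λ ^ j * Z j t ^ 2 - Λ ^ (j + 1) * Z (j + 1) t * Z (j + 2) t ≤ dZ (j + 1) t :=
    fun j t _ => (hdZsucc j t).symm.le
  -- regularity: geometric envelopes for `Z` and `dZ`
  have hreg' : ∀ T', T' < T → ∃ B : ℝ, ∀ j, ∀ t ∈ Ioo a T',
      |Z j t| ≤ B * Λ⁻¹ ^ j ∧ |dZ j t| ≤ B * Λ⁻¹ ^ j := by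
    intro T' hT'
    obtain ⟨B, hB⟩ := hreg T' hT'
    -- `|Zⱼ| = Λ⁻ʲ |Λ^{N+j} X_{N+j}| ≤ |B| Λ⁻ʲ`
    have hZb : ∀ j : ℕ, ∀ t ∈ Ioo a T', |Z j t| ≤ |B| * Λ⁻¹ ^ j := by
      intro j t ht
      have h := (hB (N + j) (by omega) t ht).trans (le_abs_self B)
      have hid : Z j t = Λ⁻¹ ^ j * (Λ ^ (N + (j : ℤ)) * X (N + (j : ℤ)) t) := by
        simp only [hZdef]
        rw [zpow_add₀ hΛne, zpow_natCast, inv_pow]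
        field_simp
      rw [hid, abs_mul, abs_of_nonneg (by positivity)]
      calc Λ⁻¹ ^ j * |Λ ^ (N + (j : ℤ)) * X (N + (j : ℤ)) t| ≤ Λ⁻¹ ^ j * |B| :=
            mul_le_mul_of_nonneg_left h (by positivity)
        _ = |B| * Λ⁻¹ ^ j := mul_comm _ _
    -- `|V| = Λ |Λ^{N-1} X_{N-1}| ≤ Λ |B|`
    have hVb : ∀ t ∈ Ioo a T', |V t| ≤ Λ * |B| := by
      intro t ht
      have h := (hB (N - 1) le_rfl t ht).trans (le_abs_self B)
      have hid : V t = Λ * (Λ ^ (N - 1) * X (N - 1) t) := by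
        simp only [hVdef]
        rw [zpow_sub_one₀ hΛne]
        field_simp
      rw [hid, abs_mul, abs_of_pos hΛ0]
      exact mul_le_mul_of_nonneg_left h hΛ0.le
    refine ⟨Λ * |B| + 2 * Λ * B ^ 2, fun j t ht => ⟨?_, ?_⟩⟩
    · -- envelope of `Z`
      have h := hZb j t ht
      have hq : 0 ≤ Λ⁻¹ ^ j := by positivity
      have : |B| * Λ⁻¹ ^ j ≤ (Λ * |B| + 2 * Λ * B ^ 2) * Λ⁻¹ ^ j := by
        apply mul_le_mul_of_nonneg_right _ hq
        nlinarith [abs_nonneg B, sq_nonneg B]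
      exact h.trans this
    · -- envelope of `dZ`
      rcases j with _ | j
      · rw [hdZ0 t, pow_zero, mul_one]
        have hx : |Z 0 t| ≤ |B| := by simpa using hZb 0 t ht
        have hy : |Z 1 t| ≤ |B| * Λ⁻¹ := by simpa using hZb 1 t ht
        have := envelope_zero hΛ (hVb t ht) hx hy
        nlinarith [abs_nonneg B, this]
      · rw [hdZsucc j t]
        have := envelope_succ hΛ (hZb j t ht) (hZb (j + 1) t ht) (hZb (j + 2) t ht)
        have hq : 0 ≤ Λ⁻¹ ^ (j + 1) := by positivity
        have h2 : 2 * Λ * B ^ 2 * Λ⁻¹ ^ (j + 1) ≤ (Λ * |B| + 2 * Λ * B ^ 2) * Λ⁻¹ ^ (j + 1) := by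
          apply mul_le_mul_of_nonneg_right _ hq
          nlinarith [abs_nonneg B]
        exact this.trans h2
  -- conclude with the ℕ-indexed statement
  have hposZ : ∀ j : ℕ, 0 ≤ Z (j + 1) t₀ := by
    intro j
    simp only [hZdef]
    exact mul_nonneg (zpow_pos hΛ0 N).le (hpos _ (by omega))
  have h := blowup_time_le hΛ hder h0 hS hreg' ht₀ hposZ
  simpa only [hZdef, Nat.cast_zero, add_zero] using h

end Corollary

end WakeRatchetDyadicTypeI

end Summit.NavierStokesRegularity.NavierStokesRegularity.Theorems

end
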